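import Summits.CriticalPhenomena.CardyFormulaZ2.Theorems.CardyFlipRussoVoronoiHubFromSmirnovDefs
import Literature.Analysis.FunctionSpaces.PoissonMappingHomeomorph
import Literature.Analysis.FunctionSpaces.PoissonPointProcessUniqueness
import Literature.Analysis.FunctionSpaces.PoissonPointProcessExistence
import Mathlib.Analysis.Complex.Isometry
import Mathlib.MeasureTheory.Measure.Lebesgue.Complex

/-!
# Euclidean-motion and scaling covariance of the homogeneous annealed Voronoi crossing probability

Helper file of the stub `stub_identification` (S4) of the line `moebius-exact-delaunay-dilation-ward`
for the crux `VoronoiHubFromSmirnov` (stmt-CriticalPhenomena-6433, route `CardyFlipRusso`).  The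
identification programme (conformal invariance ⇒ SLE₆ ⇒ Cardy) consumes, as EXACT inputs, the
covariance of the homogeneous annealed crossing probability `homCrossProb R δ` of the definitions
module under the similarities `z ↦ a z + v` of the plane (`a ≠ 0` complex):

  `homCrossProb (R.imageUnivalent h hd hi) δ = homCrossProb R (δ / ‖a‖)` whenever `h z = a z + v`,

i.e. translation invariance (`a = 1`), rotation invariance (`‖a‖ = 1`) and exact dilation
covariance (`a > 0` real: the image rectangle at mesh `δ` is the original at mesh `δ / a`).

Proof.  GEOMETRY (`crossEvent_imageUnivalent_eq_preimage`): with `u = a / ‖a‖` and the Euclidean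
motion `τ p = u⁻¹ (p − v/δ)` of CONFIGURATION space one has `τ ((a w + v)/δ) = w / (δ/‖a‖)`, so —
`τ` being an isometry, `infDist (τ p) (τ B) = infDist p B` — the closed black region of the image
rectangle at mesh `δ` for the nuclei `(c₁, c₂)` is the `h`-image of the black region of `R` at mesh
`δ/‖a‖` for the moved nuclei `(τ c₁, τ c₂)`; arcs and closure of the image rectangle are `h`-images
(`arc_imageUnivalent`, `closure_carrier_imageUnivalent`) and `h` is a homeomorphism, so continuum
paths correspond: `crossEvent (h • R) δ = (τ × τ)⁻¹' crossEvent R (δ/‖a‖)`.  PROBABILITY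
(`lawBW_preimage_prodMap`): `τ` preserves Lebesgue measure, so by Kingman's mapping theorem
(`IsPoissonPointProcess.mapHomeomorph'`) and Rényi uniqueness (`unique_holds`) the Poisson law
`poissonLaw volume` (a genuine Poisson process: Kingman existence, `isPoissonPointProcess_poissonLaw_volume`)
is `τ`-invariant, hence so is the product law `lawBW volume`; since `c ↦ (τ c₁, τ c₂)` is a
measurable EQUIVALENCE (`mapHomeomorphEquiv`), `(lawBW volume) ((τ × τ)⁻¹' A) = lawBW volume A` for
EVERY set `A` (`MeasurableEquiv.map_apply`) — no measurability of the crossing event (stub S0) is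
used.

References: J. F. C. Kingman, *Poisson Processes* (1993), §2.3 Mapping Theorem; G. Last, M. Penrose,
*Lectures on the Poisson Process* (2017), Thm 5.1, Prop. 8.3; I. Benjamini, O. Schramm, Comm. Math.
Phys. 197 (1998), §1 (Euclidean invariance of Voronoi percolation).
-/

noncomputable section

namespace Summit.CriticalPhenomena.CardyFormulaZ2.Cruxes.VoronoiHubFromSmirnov.MoebiusExactDelaunayDilationWard

open scoped Topology ENNReal
open Filter Set MeasureTheory Metric
open Literature.Analysis.FunctionSpaces
open Literature.Probability.RandomPlanarGeometry

/-! ### Geometry: the crossing event of a moved rectangle -/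

/-- Continuum paths correspond under a homeomorphism: `σ x` and `σ y` are joined in `σ '' S` iff
`x` and `y` are joined in `S`. -/
theorem joinedIn_image_homeomorph_iff (σ : ℂ ≃ₜ ℂ) (S : Set ℂ) (x y : ℂ) :
    JoinedIn (σ '' S) (σ x) (σ y) ↔ JoinedIn S x y := by
  refine ⟨fun hJ => ?_, fun hJ => hJ.map σ.continuous⟩
  have h := hJ.map σ.symm.continuous
  simpa only [Set.image_image, Homeomorph.symm_apply_apply, Set.image_id'] using h

/-- Transport of the black/white comparison: if `τ (σ w / δ) = w / δ'` for a Euclidean isometry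
`τ` of configuration space, then `σ w` is black at mesh `δ` for the nuclei `(B, W)` iff `w` is
black at mesh `δ'` for the moved nuclei `(τ B, τ W)`. -/
theorem black_transport (σ : ℂ ≃ₜ ℂ) (τ : ℂ ≃ᵢ ℂ) (δ δ' : ℝ)
    (hστ : ∀ w, τ (σ w / (δ : ℂ)) = w / (δ' : ℂ)) (B W : Set ℂ) (w : ℂ) :
    infDist (σ w / (δ : ℂ)) B ≤ infDist (σ w / (δ : ℂ)) W ↔
      infDist (w / (δ' : ℂ)) (τ '' B) ≤ infDist (w / (δ' : ℂ)) (τ '' W) := by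
  rw [← hστ w, infDist_image τ.isometry, infDist_image τ.isometry]

/-- **The crossing event of a moved rectangle** (pure geometry).  If `h = σ` is a homeomorphism of
the plane and `τ` a Euclidean isometry with `τ (σ w / δ) = w / δ'` for all `w`, then the crossing
event of the image rectangle `h • R` at mesh `δ` is the preimage, under `c ↦ (τ c₁, τ c₂)`, of the
crossing event of `R` at mesh `δ'`. -/
theorem crossEvent_imageUnivalent_eq_preimage (R : ConformalRectangle) (h : ℂ → ℂ)
    (hd : DifferentiableOn ℂ h (closure R.carrier)) (hi : InjOn h (closure R.carrier))
    (σ : ℂ ≃ₜ ℂ) (hσ : ∀ z, h z = σ z) (τ : ℂ ≃ᵢ ℂ) (δ δ' : ℝ)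
    (hστ : ∀ w, τ (σ w / (δ : ℂ)) = w / (δ' : ℂ)) :
    crossEvent (R.imageUnivalent h hd hi) δ =
      (fun c => (c.1.mapHomeomorph τ.toHomeomorph, c.2.mapHomeomorph τ.toHomeomorph)) ⁻¹'
        crossEvent R δ' := by
  obtain rfl : h = σ := funext hσ
  ext c
  simp only [crossEvent, mem_setOf_eq, mem_preimage, MarkedDomain.arc_imageUnivalent,
    MarkedDomain.closure_carrier_imageUnivalent, PointConfig.coe_mapHomeomorph,
    IsometryEquiv.coe_toHomeomorph, exists_mem_image]
  have hset : ⇑σ '' closure R.carrier ∩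
      {z | infDist (z / (δ : ℂ)) (c.1 : Set ℂ) ≤ infDist (z / (δ : ℂ)) (c.2 : Set ℂ)} =
      ⇑σ '' (closure R.carrier ∩ {z | infDist (z / (δ' : ℂ)) (τ '' (c.1 : Set ℂ)) ≤
        infDist (z / (δ' : ℂ)) (τ '' (c.2 : Set ℂ))}) := by
    rw [← image_inter_preimage]
    congr 1
    ext w
    simp only [mem_inter_iff, mem_preimage, mem_setOf_eq, black_transport σ τ δ δ' hστ]
  rw [hset]
  refine exists_congr fun x => and_congr_right fun _ => exists_congr fun y =>
    and_congr_right fun _ => ?_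
  exact joinedIn_image_homeomorph_iff σ _ x y

/-- A homeomorphism that fixes every point acts trivially on configurations. -/
theorem mapHomeomorph_eq_self_of_apply_eq (e : ℂ ≃ₜ ℂ) (he : ∀ x, e x = x) (c : PointConfig ℂ) :
    c.mapHomeomorph e = c := by
  ext x
  rw [PointConfig.mem_mapHomeomorph_iff]
  have hx : e.symm x = x := by
    conv_rhs => rw [← e.apply_symm_apply x]
    exact (he (e.symm x)).symm
  rw [hx]

/-- **Exact dilation covariance of the crossing EVENT** (registered helper of stub S4; pure
geometry, no probability): for real `a > 0`, a configuration pair crosses the dilated rectangle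
`a • R` at mesh `δ` iff it crosses `R` at mesh `δ / a` — the events are EQUAL as sets
(`z / δ = (a z) / (a δ)` after the path substitution `z ↦ a z`). -/
theorem crossEvent_imageUnivalent_mul : ∀ (R : ConformalRectangle) (a : ℝ), 0 < a →
    ∀ (δ : ℝ) (hd : DifferentiableOn ℂ (fun z : ℂ => (a : ℂ) * z) (closure R.carrier))
    (hi : InjOn (fun z : ℂ => (a : ℂ) * z) (closure R.carrier)),
      crossEvent (R.imageUnivalent (fun z : ℂ => (a : ℂ) * z) hd hi) δ = crossEvent R (δ / a) := by
  intro R a ha δ hd hi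
  have ha' : (a : ℂ) ≠ 0 := Complex.ofReal_ne_zero.2 ha.ne'
  have hστ : ∀ w, (IsometryEquiv.refl ℂ) ((Homeomorph.mulLeft₀ (a : ℂ) ha') w / (δ : ℂ)) =
      w / ((δ / a : ℝ) : ℂ) := by
    intro w
    show (a : ℂ) * w / (δ : ℂ) = w / ((δ / a : ℝ) : ℂ)
    rw [Complex.ofReal_div, div_div_eq_mul_div, mul_comm]
  rw [crossEvent_imageUnivalent_eq_preimage R (fun z : ℂ => (a : ℂ) * z) hd hi
    (Homeomorph.mulLeft₀ (a : ℂ) ha') (fun _ => rfl) (IsometryEquiv.refl ℂ) δ (δ / a) hστ]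
  ext c
  simp only [mem_preimage, mapHomeomorph_eq_self_of_apply_eq (IsometryEquiv.refl ℂ).toHomeomorph
    (fun _ => rfl)]

/-! ### Probability: Euclidean invariance of the two-colour Poisson law -/

/-- `poissonLaw volume` IS a Poisson point process of Lebesgue intensity on `ℂ` (Kingman's existence
theorem `existsUnique_isPoissonPointProcess_holds` — Lebesgue measure on `ℂ` is locally finite and
atomless — and `Classical.epsilon_spec`). -/
theorem isPoissonPointProcess_poissonLaw_volume :
    IsPoissonPointProcess volume (poissonLaw (volume : Measure ℂ)) := by
  obtain ⟨P, hP, -⟩ :=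
    existsUnique_isPoissonPointProcess_holds (E := ℂ) volume fun x => measure_singleton x
  exact Classical.epsilon_spec (p := fun Q : Measure (PointConfig ℂ) => IsPoissonPointProcess volume Q)
    ⟨P, hP⟩

/-- The two-colour law `lawBW volume` is a probability measure (a theorem, to be invoked with
`haveI`; in particular `homCrossProb R δ ∈ [0, 1]` unconditionally). -/
theorem isProbabilityMeasure_lawBW_volume : IsProbabilityMeasure (lawBW (volume : Measure ℂ)) := by
  haveI := isPoissonPointProcess_poissonLaw_volume.isProbabilityMeasure
  unfold lawBW
  infer_instance

/-- **Euclidean invariance of the Poisson law** (Kingman 1993 §2.3 mapping theorem + Rényi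
uniqueness): a Lebesgue-measure-preserving homeomorphism `e` of `ℂ` leaves `poissonLaw volume`
invariant, `(poissonLaw volume).map (c ↦ e c) = poissonLaw volume`. -/
theorem map_mapHomeomorph_poissonLaw_volume (e : ℂ ≃ₜ ℂ)
    (he : MeasurePreserving e (volume : Measure ℂ) volume) :
    (poissonLaw volume).map (PointConfig.mapHomeomorph e) = poissonLaw (volume : Measure ℂ) := by
  have h := isPoissonPointProcess_poissonLaw_volume.mapHomeomorph' e
  rw [he.map_eq] at h
  exact IsPoissonPointProcess.unique_holds h isPoissonPointProcess_poissonLaw_volume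

/-- **Euclidean invariance of the two-colour law, for ALL sets**: for a Lebesgue-measure-preserving
homeomorphism `e` of `ℂ` and EVERY `A` (measurable or not — `Measure` is an outer measure and
`c ↦ (e c₁, e c₂)` a measurable equivalence), `lawBW volume ((e × e)⁻¹' A) = lawBW volume A`. -/
theorem lawBW_preimage_prodMap (e : ℂ ≃ₜ ℂ) (he : MeasurePreserving e (volume : Measure ℂ) volume)
    (A : Set (PointConfig ℂ × PointConfig ℂ)) :
    lawBW volume ((fun c => (c.1.mapHomeomorph e, c.2.mapHomeomorph e)) ⁻¹' A) =
      lawBW (volume : Measure ℂ) A := by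
  haveI := isPoissonPointProcess_poissonLaw_volume.isProbabilityMeasure
  have hΦ : (fun c : PointConfig ℂ × PointConfig ℂ => (c.1.mapHomeomorph e, c.2.mapHomeomorph e)) =
      ⇑((PointConfig.mapHomeomorphEquiv e).prodCongr (PointConfig.mapHomeomorphEquiv e)) := rfl
  rw [hΦ, ← MeasurableEquiv.map_apply]
  congr 1
  change (lawBW volume).map (Prod.map (PointConfig.mapHomeomorph e) (PointConfig.mapHomeomorph e)) =
    lawBW volume
  unfold lawBW
  rw [← Measure.map_prod_map _ _ (PointConfig.measurable_mapHomeomorph e)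
    (PointConfig.measurable_mapHomeomorph e), map_mapHomeomorph_poissonLaw_volume e he]

/-- The same invariance for the real-valued measure `Measure.real`. -/
theorem lawBW_real_preimage_prodMap (e : ℂ ≃ₜ ℂ)
    (he : MeasurePreserving e (volume : Measure ℂ) volume) (A : Set (PointConfig ℂ × PointConfig ℂ)) :
    (lawBW volume).real ((fun c => (c.1.mapHomeomorph e, c.2.mapHomeomorph e)) ⁻¹' A) =
      (lawBW (volume : Measure ℂ)).real A := by
  simp only [measureReal_def, lawBW_preimage_prodMap e he A]

/-! ### Covariance of `homCrossProb` under similarities -/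

/-- **Covariance of the homogeneous annealed crossing probability under similarities** (registered
helper of stub S4): for `h z = a z + v` with `a ≠ 0`, the image rectangle `h • R` at mesh `δ` has the
crossing probability of `R` at mesh `δ / ‖a‖` — translation and rotation invariance and exact
dilation covariance of annealed Poisson–Voronoi percolation in one formula. -/
theorem homCrossProb_imageUnivalent_affine : ∀ (R : ConformalRectangle) (h : ℂ → ℂ) (a v : ℂ),
    a ≠ 0 → (∀ z, h z = a * z + v) → ∀ (δ : ℝ) (hd : DifferentiableOn ℂ h (closure R.carrier))
    (hi : InjOn h (closure R.carrier)),
      homCrossProb (R.imageUnivalent h hd hi) δ = homCrossProb R (δ / ‖a‖) := by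
  intro R h a v ha hh δ hd hi
  have hna : (‖a‖ : ℂ) ≠ 0 := Complex.ofReal_ne_zero.2 (norm_ne_zero_iff.2 ha)
  -- the similarity as a homeomorphism of the plane
  set σ : ℂ ≃ₜ ℂ := (Homeomorph.mulLeft₀ a ha).trans (Homeomorph.addRight v) with hσdef
  have hσ : ∀ z, h z = σ z := fun z => by rw [hh z]; rfl
  -- the Euclidean motion of configuration space
  obtain ⟨u, hu⟩ : ∃ u : Circle, (u : ℂ) = a / (‖a‖ : ℂ) :=
    ⟨⟨a / (‖a‖ : ℂ), by simp [Submonoid.unitSphere, ha]⟩, rfl⟩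
  set τ : ℂ ≃ᵢ ℂ := (IsometryEquiv.subRight (v / (δ : ℂ))).trans (rotation u⁻¹).toIsometryEquiv
    with hτdef
  have hτapply : ∀ p, τ p = (a / (‖a‖ : ℂ))⁻¹ * (p - v / (δ : ℂ)) := fun p => by
    simp only [hτdef, IsometryEquiv.trans_apply, LinearIsometryEquiv.coe_toIsometryEquiv,
      rotation_apply, IsometryEquiv.subRight_apply, Circle.coe_inv, hu]
  have hστ : ∀ w, τ (σ w / (δ : ℂ)) = w / ((δ / ‖a‖ : ℝ) : ℂ) := by
    intro w
    rw [hτapply, ← hσ, hh, Complex.ofReal_div]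
    rcases eq_or_ne (δ : ℂ) 0 with hδ | hδ
    · simp [hδ]
    · field_simp
      ring
  have hτvol : MeasurePreserving τ.toHomeomorph (volume : Measure ℂ) volume := by
    have hfun : (⇑τ.toHomeomorph : ℂ → ℂ) = ⇑(rotation u⁻¹) ∘ fun z => z - v / (δ : ℂ) := by
      ext z
      simp [hτdef]
    rw [hfun]
    exact (rotation u⁻¹).measurePreserving.comp (measurePreserving_sub_right volume _)
  unfold homCrossProb
  rw [crossEvent_imageUnivalent_eq_preimage R h hd hi σ hσ τ δ (δ / ‖a‖) hστ,
    lawBW_real_preimage_prodMap τ.toHomeomorph hτvol]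

/-- **Exact dilation covariance** (registered helper of stub S4): for real `a > 0` the dilated
rectangle `a • R` at mesh `δ` has EXACTLY the crossing probability of `R` at mesh `δ / a`. -/
theorem homCrossProb_imageUnivalent_mul : ∀ (R : ConformalRectangle) (a : ℝ), 0 < a →
    ∀ (δ : ℝ) (hd : DifferentiableOn ℂ (fun z : ℂ => (a : ℂ) * z) (closure R.carrier))
    (hi : InjOn (fun z : ℂ => (a : ℂ) * z) (closure R.carrier)),
      homCrossProb (R.imageUnivalent (fun z : ℂ => (a : ℂ) * z) hd hi) δ = homCrossProb R (δ / a) := by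
  intro R a ha δ hd hi
  have h := homCrossProb_imageUnivalent_affine R (fun z : ℂ => (a : ℂ) * z) a 0
    (Complex.ofReal_ne_zero.2 ha.ne') (fun z => (add_zero _).symm) δ hd hi
  rwa [Complex.norm_real, Real.norm_of_nonneg ha.le] at h

/-- **Translation invariance** (registered helper of stub S4): the translate `R + v` has the same
crossing probability as `R` at every mesh. -/
theorem homCrossProb_imageUnivalent_add : ∀ (R : ConformalRectangle) (v : ℂ) (δ : ℝ)
    (hd : DifferentiableOn ℂ (fun z : ℂ => z + v) (closure R.carrier))
    (hi : InjOn (fun z : ℂ => z + v) (closure R.carrier)),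
      homCrossProb (R.imageUnivalent (fun z : ℂ => z + v) hd hi) δ = homCrossProb R δ := by
  intro R v δ hd hi
  have h := homCrossProb_imageUnivalent_affine R (fun z : ℂ => z + v) 1 v one_ne_zero
    (fun z => by rw [one_mul]) δ hd hi
  rwa [norm_one, div_one] at h

/-- **Rotation invariance** (registered helper of stub S4): for `‖u‖ = 1` the rotated rectangle
`u • R` has the same crossing probability as `R` at every mesh. -/
theorem homCrossProb_imageUnivalent_rotate : ∀ (R : ConformalRectangle) (u : ℂ), ‖u‖ = 1 →
    ∀ (δ : ℝ) (hd : DifferentiableOn ℂ (fun z : ℂ => u * z) (closure R.carrier))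
    (hi : InjOn (fun z : ℂ => u * z) (closure R.carrier)),
      homCrossProb (R.imageUnivalent (fun z : ℂ => u * z) hd hi) δ = homCrossProb R δ := by
  intro R u hu δ hd hi
  have h := homCrossProb_imageUnivalent_affine R (fun z : ℂ => u * z) u 0
    (norm_ne_zero_iff.1 (by rw [hu]; exact one_ne_zero)) (fun z => (add_zero _).symm) δ hd hi
  rwa [hu, div_one] at h

/-- Covariance for the tree's similar image `MarkedDomain.affineImage R c w hc` (`z ↦ c z + w`,
`c ≠ 0`): mesh `δ` on `c • R + w` is mesh `δ / ‖c‖` on `R`. -/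
theorem homCrossProb_affineImage (R : ConformalRectangle) (c w : ℂ) (hc : c ≠ 0) (δ : ℝ) :
    homCrossProb (MarkedDomain.affineImage R c w hc) δ = homCrossProb R (δ / ‖c‖) :=
  homCrossProb_imageUnivalent_affine R _ c w hc (fun _ => rfl) δ _ _

/-- Translation invariance for the tree's translate `MarkedDomain.translate R v = R + v`. -/
theorem homCrossProb_translate (R : ConformalRectangle) (v : ℂ) (δ : ℝ) :
    homCrossProb (MarkedDomain.translate R v) δ = homCrossProb R δ :=
  homCrossProb_imageUnivalent_add R v δ _ _

/-- **Asymptotic scale invariance from asymptotic conformal invariance**: under `ConformalNull`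
(the hypothesis of stub S4), applied to the entire similarity `z ↦ a z`, exact dilation covariance
turns the `o(1)` transport statement into `homCrossProb R (δ / a) − homCrossProb R δ → 0` as
`δ → 0⁺`, for every `a > 0` — the crossing probability is slowly varying in the mesh, so its set of
subsequential limits is the same along `δ` and along `δ / a`. -/
theorem tendsto_homCrossProb_div_sub_of_conformalNull (hCN : ConformalNull) (R : ConformalRectangle)
    {a : ℝ} (ha : 0 < a) :
    Tendsto (fun δ => homCrossProb R (δ / a) - homCrossProb R δ) (𝓝[>] 0) (𝓝 0) := by
  have ha' : (a : ℂ) ≠ 0 := Complex.ofReal_ne_zero.2 ha.ne'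
  have hd : DifferentiableOn ℂ (fun z : ℂ => (a : ℂ) * z) univ :=
    (differentiable_id.const_mul (a : ℂ)).differentiableOn
  have hi : InjOn (fun z : ℂ => (a : ℂ) * z) univ := fun x _ y _ hxy => mul_left_cancel₀ ha' hxy
  refine (hCN R (fun z : ℂ => (a : ℂ) * z) univ isOpen_univ (subset_univ _) hd hi).congr' ?_
  exact Eventually.of_forall fun δ => by
    dsimp only
    rw [homCrossProb_imageUnivalent_mul R a ha δ]

end Summit.CriticalPhenomena.CardyFormulaZ2.Cruxes.VoronoiHubFromSmirnov.MoebiusExactDelaunayDilationWard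

end
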